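import Literature.MathematicalPhysics.QuantumFieldTheory.Balaban1983to89.B13DirichletLocalCLetters
import Literature.MathematicalPhysics.QuantumFieldTheory.Balaban1983to89.B13DirichletLocalXLetters
import Literature.MathematicalPhysics.QuantumFieldTheory.Balaban1983to89.B13ScaledPencilAveraging
import Literature.MathematicalPhysics.QuantumFieldTheory.Balaban1983to89.B13MatrixUnitBasisNumerals

/-!
# `Balaban1983to89.B13DirichletLocalXCLettersScaled` — T. Bałaban, *Propagators for lattice gauge theories in a background field*, Commun. Math. Phys. **99** (1985) 389–434
# [Balaban1985BackgroundPropagators], (3.19)–(3.25) pp. 393–395, (3.35)–(3.37) p. 396 («|A′| < α₁(Lʲη)⁻¹ on Ω_j»), (3.40) p. 397, Sect. C pp. 408–409 («G′_□(U), C_□(U) =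
# (Q′(U)G′_□²(U)Q′*(U))⁻¹»), (3.87) p. 409, Thm 3.2 (3.48) p. 398, Thm 3.4 p. 400, Thm 3.10 (3.108) p. 416, Thm 3.11 p. 416; [Balaban1984PropagatorsI] p. 25; [Balaban1984PropagatorsII]
# Prop 2.3 p. 238, (2.54) p. 232, Lemma 2.1 (2.61) p. 234, (2.69) p. 235; [Balaban1988RG2Cluster] (2.5)–(2.7) pp. 12–13, p. 15:
# ★★★ STATION L2 OF THE LOCAL-CUBE ROAD AT THE (3.37)-SCALED PENCIL — `X_□` and `C_□` along `A″ ↦ e^{iη·w·A″}U₀` (blockwise weight `|w| ≤ (L^{lev})⁻¹`) at def-Y's v4 letter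
# about every unitary-valued background, with the LEVEL-FREE transporter numeral `e^{(d+1)|η|Rc}` of this seat's W4 `B13ScaledPencilAveraging` and the centre DISCHARGED
# (`e^{iη·w·0}U₀ = U₀`, `B13DirichletLocalCLetters` §1) — dag-n10-w6's L3 INPUT `hC` at the scaled pencil, fed by `G′_□`'s scaled-pencil letters (displayed).

[folklore] bookkeeping: compositions of this seat's family-generic stations (`B13DirichletLocalXLetters` §2, `B13DirichletLocalCLetters` §1–§2) with W4's binders BY NAME; THEOREMS
ONLY (no `def`, no instance, no notation); nothing of NODE 00's modified; nothing here is a claim about the Yang–Mills mass gap; no node is discharged; count-neutral.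

WHAT THIS FILE PROVES (seat `pub-ymgap-dag-n10-w5` g4; `𝔸 = M_N(ℂ)`, matrix units, `G ≤ U(N)`, `G`-valued `U₀`, `1 ≤ N`; weight binder `hw : ∀ y, |w y| ≤ (L^{lev(blkOf(toBox y))})⁻¹`).
* §1 ★★ `rawEntryLetters_toMatrix_XY_parSymY_scaledPencil_of_mem`: `G′_□`'s letters along the scaled pencil on sites `(Rc, ρ, B_G′)` (DISPLAYED) + NODE 00's numerals `CQ, CQs, r`,
  readings, fibre `m_S`, `0 < μ ≤ ρ` ⟹ `X_□`'s letters on blocks at rate `ρ − μ`, X §2's constant with `KQ = e^{(d+1)|η|Rc}` (`cb = cl = 1`).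
* §2 `scaledPencil_zero`, ★★★ `rawEntryLetters_toMatrix_ClocY_parSymY_scaledPencil_of_XLetters` (`X_□`'s scaled-pencil letters displayed ⟹ `hC` along the scaled pencil, centre
  discharged, `m = (4(d+1)+1)⁻²`, `Θ = √((L^k)^{d+1})`), ★★★ `rawEntryLetters_toMatrix_ClocY_parSymY_scaledPencil_of_GsqLetters` (`hG` in → `hC` out; the X-constant bound once
  by `hBX`, `rfl` at the call site; NO N06 hypothesis).
HONEST FRAMING: [folklore] compositions; `G′_□`'s scaled-pencil letters are DISPLAYED (L1's scaled instance is not in the tree); the reading range numeral `r` and the rates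
remain the located road's (finite-lattice; print's multi-scale rate (3.48) NOT claimed — the scaled pencil removes the level from the TRANSPORTER numeral only); the weight is a
binder (which weight ∕ readings are «of record» is NODE 00's ∕ def-T's word); nothing of Bałaban's asserted beyond the cited theorems; N06 ∕ N10 NOT discharged; K1⁹ NOT closed;
counts unmoved (typed 28∕28 · discharged 5∕27); 0 `def`, 0 `sorry`, standard axioms; one finite 𝕋⁴ programme at fixed ε — R4 closes the conditional finite-𝕋⁴ rung
`BalabanLadder.UV` only; the YM mass gap (Clay) is NOT proved by any of this; nothing continuum ∕ ℝ⁴ ∕ OS.  Filed `--kind proof --supports` K1⁹ (stmt-QuantumFields-27364).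
-/

noncomputable section

namespace Literature.MathematicalPhysics.QuantumFieldTheory.Balaban1983to89.B13DirichletLocalXCLettersScaled

open Metric Set Finset Module
open scoped Matrix Matrix.Norms.L2Operator
open Literature.MathematicalPhysics.QuantumFieldTheory.Balaban1983to89
open Literature.MathematicalPhysics.QuantumFieldTheory.Balaban1983to89.B9Thm37GlueTorus (tdist1)
open Literature.MathematicalPhysics.QuantumFieldTheory.Balaban1983to89.B5TorusCover (UT)
open Literature.MathematicalPhysics.QuantumFieldTheory.Balaban1983to89.B9Thm311ReadingCoords (trIP)
open Literature.MathematicalPhysics.QuantumFieldTheory.Balaban1983to89.B13EntrywiseWalks (RawEntryLetters)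
open Literature.MathematicalPhysics.QuantumFieldTheory.Balaban1983to89.B9Thm37CubeCoverCommutators (cutMulY)
open Literature.MathematicalPhysics.QuantumFieldTheory.Balaban1983to89.B9Thm311ReadingAtLetters (wB)
open Literature.MathematicalPhysics.QuantumFieldTheory.Balaban1983to89.B9Thm39CubeOpsAtLettersY (blkIndY blkIndY_zero_one)
open Literature.MathematicalPhysics.QuantumFieldTheory.Balaban1983to89.B13MatrixUnitBasisNumerals (norm_stdBasis_repr_le norm_stdBasis_le_one)
open Literature.MathematicalPhysics.QuantumFieldTheory.Balaban1983to89.B13DirichletLocalXLetters (rawEntryLetters_toMatrix_XY_of_family)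
open Literature.MathematicalPhysics.QuantumFieldTheory.Balaban1983to89.B13DirichletLocalCLetters (trIP_padXlocY_parSymY_ge rawEntryLetters_toMatrix_ClocY_of_family)
open Literature.MathematicalPhysics.QuantumFieldTheory.Balaban1983to89.B13ScaledPencilAveraging
  (differentiableOn_qpT_parSymY_scaledPencil norm_qpT_parSymY_scaledPencil_binders_of_mem)
open Literature.MathematicalPhysics.QuantumFieldTheory.Balaban1983to89.B9Eq39Adjoint (prodCfg)
open Literature.MathematicalPhysics.QuantumFieldTheory.Balaban1983to89.B9Eq369Product (prodCfg_zero)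
open Literature.MathematicalPhysics.QuantumFieldTheory.Balaban1983to89.B6GlobalChartV1 (PV boxEquiv toBox)
open Literature.MathematicalPhysics.QuantumFieldTheory.Balaban1983to89.B6KLevelCensusIndexV1 (KIdx)
open Literature.MathematicalPhysics.QuantumFieldTheory.Balaban1983to89.B6Geom246MultiLevelBox (blkOf)
open Literature.MathematicalPhysics.QuantumFieldTheory.Balaban1983to89.Node00.OpsYLocalInverse (GsqY)
open Literature.MathematicalPhysics.QuantumFieldTheory.Balaban1983to89.Node00.OpsYDeltaALocal (padXlocY ClocY)
open Literature.MathematicalPhysics.QuantumFieldTheory.Balaban1983to89.Node00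

variable {d ℓ : ℕ} {hd : 1 ≤ d + 1} {hL : Odd (ℓ + 1) ∧ 1 < ℓ + 1} {b₀ b₁ : ℝ} {N : ℕ} [NeZero N]
variable (i : KIdx d ℓ hd hL b₀ b₁) {G : Subgroup (Matrix (Fin N) (Fin N) ℂ)ˣ} [DecidableEq (SiteY i)] [DecidableEq (BlkY i)]
variable {ν : ℕ} {Nf : Fin ν → ℕ} [∀ j, NeZero (Nf j)]

/-! ## §1. ★★ `X_□` along the (3.37)-scaled pencil at the v4 letter about a unitary-valued background — the transporter numeral is `e^{(d+1)|η|Rc}`, level-free -/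

/-- ★★ **THE X-STATION ALONG THE SCALED PENCIL** (`G ≤ U(N)`, `G`-valued `U₀`, matrix units, v4 letter `parSymY`, ANY site set `D`): from `G′_□`'s letters along the scaled pencil
`A″ ↦ e^{iη·w·A″}U₀` on sites `(Rc, ρ, B_G′)` (DISPLAYED — L1's scaled instance), the blockwise weight bound `|w| ≤ (L^{lev})⁻¹`, NODE 00's kernel numerals `CQ, CQs`, readings
`ℓS, ℓB` with range `r`, a fibre bound `m_S`, `0 < μ ≤ ρ`: the letters of `A″ ↦ toMatrix B_B B_B (X_□(e^{iη·w·A″}U₀))` on blocks at rate `ρ − μ` with this seat's X §2 constant at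
the LEVEL-FREE transporter numeral `KQ = e^{(d+1)|η|Rc}` (W4 `norm_qpT_parSymY_scaledPencil_binders_of_mem`, `differentiableOn_qpT_parSymY_scaledPencil`).
[cite: Balaban1985BackgroundPropagators, (3.19)–(3.21), (3.24)–(3.25) pp.393–395, (3.35)–(3.37) p.396, (3.40) p.397, (3.87) p.409, Thm 3.10 (3.108) p.416; Balaban1988RG2Cluster, (2.5)–(2.6) p.12, p.15] -/
theorem rawEntryLetters_toMatrix_XY_parSymY_scaledPencil_of_mem (hG : G ≤ B7Prop2Explicit.unitaryUnits (Matrix (Fin N) (Fin N) ℂ))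
    {U₀ : CfgY (Matrix (Fin N) (Fin N) ℂ) i} (hU : ∀ μ x, U₀ μ x ∈ G) (η : ℝ) (w : Site (PV d ℓ i.m i.K hd hL) 0 → ℝ)
    (hw : ∀ y, |w y| ≤ ((((ℓ : ℝ) + 1) ^ (blkOf i.D.toDomains (toBox i.hN y)).1.1))⁻¹) (D : Finset (SiteY i)) {Rc : ℝ} (hRc : 0 ≤ Rc)
    {CQ CQs : ℝ} (hCQ0 : 0 ≤ CQ) (hCQ : ∀ s, ∑ z, |qpK i s z| ≤ CQ) (hCQs0 : 0 ≤ CQs) (hCQs : ∀ s, ∑ z, |qpsK i z s| ≤ CQs)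
    (ℓS : SiteY i → UT Nf) (ℓB : BlkY i → UT Nf) {r : ℝ}
    (hℓQ : ∀ s z, qpK i s z ≠ 0 → tdist1 Nf (ℓB s) (ℓS z) ≤ r) (hℓQs : ∀ z s, qpsK i z s ≠ 0 → tdist1 Nf (ℓS z) (ℓB s) ≤ r)
    {mS : ℕ} (hfibS : ∀ y : UT Nf, (univ.filter fun q : SiteY i × (Fin N × Fin N) => ℓS q.1 = y).card ≤ mS)
    {ρ BG μ : ℝ}
    (hGsq : RawEntryLetters (fun u : Fin (d + 1) → Site (PV d ℓ i.m i.K hd hL) 0 → Matrix (Fin N) (Fin N) ℂ =>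
      LinearMap.toMatrix
        ((Pi.basis fun _ : SiteY i => Matrix.stdBasis ℂ (Fin N) (Fin N)).reindex (Equiv.sigmaEquivProd (SiteY i) (Fin N × Fin N)))
        ((Pi.basis fun _ : SiteY i => Matrix.stdBasis ℂ (Fin N) (Fin N)).reindex (Equiv.sigmaEquivProd (SiteY i) (Fin N × Fin N)))
        (GsqY i (parSymY i) D (prodCfg U₀ η (fun μ y => ((w y : ℝ) : ℂ) • u μ y)))) (fun q : SiteY i × (Fin N × Fin N) => ℓS q.1) Rc ρ BG)
    (hμ : 0 < μ) (hμρ : μ ≤ ρ) :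
    RawEntryLetters (fun u : Fin (d + 1) → Site (PV d ℓ i.m i.K hd hL) 0 → Matrix (Fin N) (Fin N) ℂ =>
        LinearMap.toMatrix
          ((Pi.basis fun _ : BlkY i => Matrix.stdBasis ℂ (Fin N) (Fin N)).reindex (Equiv.sigmaEquivProd (BlkY i) (Fin N × Fin N)))
          ((Pi.basis fun _ : BlkY i => Matrix.stdBasis ℂ (Fin N) (Fin N)).reindex (Equiv.sigmaEquivProd (BlkY i) (Fin N × Fin N)))
          (XY i (parSymY i) (GsqY i (parSymY i) D) (prodCfg U₀ η (fun μ y => ((w y : ℝ) : ℂ) • u μ y))))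
      (fun p : BlkY i × (Fin N × Fin N) => ℓB p.1) Rc (ρ - μ)
      (CQ * (Fintype.card (Fin N × Fin N) : ℝ) * (1 * (Real.exp (((d : ℝ) + 1) * (|η| * Rc)) * 1 * Real.exp (((d : ℝ) + 1) * (|η| * Rc)))) *
        (CQs * (Fintype.card (Fin N × Fin N) : ℝ) * (1 * (Real.exp (((d : ℝ) + 1) * (|η| * Rc)) * 1 * Real.exp (((d : ℝ) + 1) * (|η| * Rc))))) *
        (BG * BG * (mS * B6.c0 1 μ ^ ν)) * Real.exp (2 * (ρ - μ) * r)) := by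
  obtain ⟨hQf, hQb, hQsf, hQsb⟩ := norm_qpT_parSymY_scaledPencil_binders_of_mem i hG hU η hRc w hw
  exact rawEntryLetters_toMatrix_XY_of_family i (Matrix.stdBasis ℂ (Fin N) (Fin N)) (parSymY i)
    (fun u : Fin (d + 1) → Site (PV d ℓ i.m i.K hd hL) 0 → Matrix (Fin N) (Fin N) ℂ => prodCfg U₀ η (fun μ y => ((w y : ℝ) : ℂ) • u μ y))
    (GsqY i (parSymY i) D) norm_stdBasis_repr_le zero_le_one norm_stdBasis_le_one zero_le_one (Real.exp_pos _).le
    (fun s z => (differentiableOn_qpT_parSymY_scaledPencil i U₀ η w hw s z).1) (fun s z => (differentiableOn_qpT_parSymY_scaledPencil i U₀ η w hw s z).2)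
    hQf hQb hQsf hQsb hCQ0 hCQ hCQs0 hCQs ℓS ℓB hℓQ hℓQs hfibS hGsq hμ hμρ

/-! ## §2. ★★★ `C_□` along the scaled pencil at the v4 letter: the centre sits at `U₀` itself (`w·0 = 0`), discharged by `B13DirichletLocalCLetters` §1 -/

omit [NeZero N] [DecidableEq (SiteY i)] [DecidableEq (BlkY i)] in
/-- the scaled pencil passes through the background at `A″ = 0`: `e^{iη·w·0}U₀ = U₀`. [cite: Balaban1985BackgroundPropagators, (3.37) p.396, p.390 («U = U′U₀»), bookkeeping] -/
theorem scaledPencil_zero (U₀ : CfgY (Matrix (Fin N) (Fin N) ℂ) i) (η : ℝ) (w : Site (PV d ℓ i.m i.K hd hL) 0 → ℝ) :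
    prodCfg U₀ η (fun μ y => ((w y : ℝ) : ℂ) • (0 : Fin (d + 1) → Site (PV d ℓ i.m i.K hd hL) 0 → Matrix (Fin N) (Fin N) ℂ) μ y) = U₀ := by
  have h0 : (fun μ y => ((w y : ℝ) : ℂ) • (0 : Fin (d + 1) → Site (PV d ℓ i.m i.K hd hL) 0 → Matrix (Fin N) (Fin N) ℂ) μ y) = 0 := by
    funext μ y; simp
  rw [h0, prodCfg_zero]

omit [NeZero N] [DecidableEq (SiteY i)] in
/-- ★★★ **THE `C_□`-STATION ALONG THE SCALED PENCIL, CENTRE DISCHARGED** (`G ≤ U(N)`, `G`-valued `U₀`, matrix units, v4 letter, block set `Dblk` with sites in `D`): from `X_□`'s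
letters along the scaled pencil on blocks `(R, ρ, B_X)` (§1), a fibre bound and the window at `m = (4(d+1)+1)⁻²`:
`RawEntryLetters (A″ ↦ toMatrix B_B B_B (C_□(e^{iη·w·A″}U₀))) (ℓB ∘ fst) R′ κ (1·Θ·(4∕m′))` — `B13DirichletLocalCLetters.rawEntryLetters_toMatrix_ClocY_of_family` at the scaled
family, the centre `e^{iη·w·0}U₀ = U₀` by `trIP_padXlocY_parSymY_ge`; = dag-n10-w6's `hC` along the scaled pencil.
[cite: Balaban1985BackgroundPropagators, (3.25) p.394, (3.37) p.396, (3.87) p.409, Thm 3.2 (3.48) p.398, Thm 3.4 p.400, Thm 3.10 (3.108) p.416, Thm 3.11 p.416; Balaban1984PropagatorsI, p.25;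
Balaban1984PropagatorsII, Prop 2.3 p.238, Lemma 2.1 (2.61) p.234, (2.69) p.235; Balaban1988RG2Cluster, (2.5)–(2.7) pp.12–13, p.15] -/
theorem rawEntryLetters_toMatrix_ClocY_parSymY_scaledPencil_of_XLetters (hG : G ≤ B7Prop2Explicit.unitaryUnits (Matrix (Fin N) (Fin N) ℂ))
    {U₀ : CfgY (Matrix (Fin N) (Fin N) ℂ) i} (hU : ∀ μ x, U₀ μ x ∈ G) (η : ℝ) (w : Site (PV d ℓ i.m i.K hd hL) 0 → ℝ)
    (D : Finset (SiteY i)) {Dblk : Finset (BlkY i)} (hDD : ∀ z : SiteY i, blkOf i.D.toDomains z ∈ Dblk → z ∈ D) (ℓB : BlkY i → UT Nf) {R R' ρ BX : ℝ}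
    (hX : RawEntryLetters (fun u : Fin (d + 1) → Site (PV d ℓ i.m i.K hd hL) 0 → Matrix (Fin N) (Fin N) ℂ =>
      LinearMap.toMatrix
        ((Pi.basis fun _ : BlkY i => Matrix.stdBasis ℂ (Fin N) (Fin N)).reindex (Equiv.sigmaEquivProd (BlkY i) (Fin N × Fin N)))
        ((Pi.basis fun _ : BlkY i => Matrix.stdBasis ℂ (Fin N) (Fin N)).reindex (Equiv.sigmaEquivProd (BlkY i) (Fin N × Fin N)))
        (XY i (parSymY i) (GsqY i (parSymY i) D) (prodCfg U₀ η (fun μ y => ((w y : ℝ) : ℂ) • u μ y))))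
      (fun p : BlkY i × (Fin N × Fin N) => ℓB p.1) R ρ BX)
    (hρ : 0 < ρ) {mB : ℕ} (hfibB : ∀ y : UT Nf, (univ.filter fun p : BlkY i × (Fin N × Fin N) => ℓB p.1 = y).card ≤ mB)
    (hR' : 0 ≤ R') (hR'R : R' ≤ R)
    (hmarg : 0 < ((4 * ((d : ℝ) + 1) + 1) ^ 2)⁻¹ -
      2 * ((Real.sqrt ((((ℓ : ℝ) + 1) ^ i.k) ^ (d + 1)) * 1 * (BX + 1)) * (mB * B6.c0 1 ρ ^ ν)) * R' / R)
    {κ : ℝ} (hκ : 0 ≤ κ) (hκ4 : κ ≤ ρ / 4)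
    (hκm : 8 * (Real.sqrt ((((ℓ : ℝ) + 1) ^ i.k) ^ (d + 1)) * 1 * (BX + 1)) * κ * (mB * B6.c0 1 (ρ / 2) ^ ν) ≤
      (((4 * ((d : ℝ) + 1) + 1) ^ 2)⁻¹ - 2 * ((Real.sqrt ((((ℓ : ℝ) + 1) ^ i.k) ^ (d + 1)) * 1 * (BX + 1)) * (mB * B6.c0 1 ρ ^ ν)) * R' / R) * ρ) :
    RawEntryLetters (fun u : Fin (d + 1) → Site (PV d ℓ i.m i.K hd hL) 0 → Matrix (Fin N) (Fin N) ℂ =>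
        LinearMap.toMatrix
          ((Pi.basis fun _ : BlkY i => Matrix.stdBasis ℂ (Fin N) (Fin N)).reindex (Equiv.sigmaEquivProd (BlkY i) (Fin N × Fin N)))
          ((Pi.basis fun _ : BlkY i => Matrix.stdBasis ℂ (Fin N) (Fin N)).reindex (Equiv.sigmaEquivProd (BlkY i) (Fin N × Fin N)))
          (ClocY i (parSymY i) D (cutMulY (blkIndY i Dblk)) (prodCfg U₀ η (fun μ y => ((w y : ℝ) : ℂ) • u μ y))))
      (fun p : BlkY i × (Fin N × Fin N) => ℓB p.1) R'
      κ (1 * Real.sqrt ((((ℓ : ℝ) + 1) ^ i.k) ^ (d + 1)) *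
        (4 / (((4 * ((d : ℝ) + 1) + 1) ^ 2)⁻¹ -
          2 * ((Real.sqrt ((((ℓ : ℝ) + 1) ^ i.k) ^ (d + 1)) * 1 * (BX + 1)) * (mB * B6.c0 1 ρ ^ ν)) * R' / R))) := by
  have hco : ∀ Ψ : BlkY i → Matrix (Fin N) (Fin N) ℂ, ((4 * ((d : ℝ) + 1) + 1) ^ 2)⁻¹ * trIP (wB i) Ψ Ψ ≤
      trIP (wB i) Ψ (padXlocY i (parSymY i) D (cutMulY (blkIndY i Dblk))
        (prodCfg U₀ η (fun μ y => ((w y : ℝ) : ℂ) • (0 : Fin (d + 1) → Site (PV d ℓ i.m i.K hd hL) 0 → Matrix (Fin N) (Fin N) ℂ) μ y)) Ψ) := fun Ψ => by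
    rw [scaledPencil_zero]; exact trIP_padXlocY_parSymY_ge i hG hU hDD Ψ
  exact rawEntryLetters_toMatrix_ClocY_of_family i (parSymY i)
    (fun u : Fin (d + 1) → Site (PV d ℓ i.m i.K hd hL) 0 → Matrix (Fin N) (Fin N) ℂ => prodCfg U₀ η (fun μ y => ((w y : ℝ) : ℂ) • u μ y))
    D (blkIndY_zero_one i Dblk) ℓB hX hρ hfibB hco hR' hR'R hmarg hκ hκ4 hκm

/-- ★★★ **THE `C_□`-STATION ALONG THE SCALED PENCIL FED BY `G′_□`'s SCALED-PENCIL LETTERS** (`hG` in — L1's scaled instance, DISPLAYED — w6's `hC` out; the X-constant, built on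
the LEVEL-FREE transporter numeral `e^{(d+1)|η|Rc}`, bound ONCE by `hBX`, `rfl` at the call site; NO N06 hypothesis).
[cite: Balaban1985BackgroundPropagators, (3.19)–(3.25) pp.393–395, (3.35)–(3.37) p.396, (3.40) p.397, (3.87) p.409, Thm 3.2 (3.48) p.398, Thm 3.4 p.400, Thm 3.10 (3.108) p.416, Thm 3.11 p.416;
Balaban1984PropagatorsI, p.25; Balaban1984PropagatorsII, Prop 2.3 p.238, (2.54) p.232, Lemma 2.1 (2.61) p.234; Balaban1988RG2Cluster, (2.5)–(2.7) pp.12–13, p.15] -/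
theorem rawEntryLetters_toMatrix_ClocY_parSymY_scaledPencil_of_GsqLetters (hG : G ≤ B7Prop2Explicit.unitaryUnits (Matrix (Fin N) (Fin N) ℂ))
    {U₀ : CfgY (Matrix (Fin N) (Fin N) ℂ) i} (hU : ∀ μ x, U₀ μ x ∈ G) (η : ℝ) (w : Site (PV d ℓ i.m i.K hd hL) 0 → ℝ)
    (hw : ∀ y, |w y| ≤ ((((ℓ : ℝ) + 1) ^ (blkOf i.D.toDomains (toBox i.hN y)).1.1))⁻¹)
    (D : Finset (SiteY i)) {Dblk : Finset (BlkY i)} (hDD : ∀ z : SiteY i, blkOf i.D.toDomains z ∈ Dblk → z ∈ D) {Rc : ℝ} (hRc : 0 < Rc)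
    {CQ CQs : ℝ} (hCQ0 : 0 ≤ CQ) (hCQ : ∀ s, ∑ z, |qpK i s z| ≤ CQ) (hCQs0 : 0 ≤ CQs) (hCQs : ∀ s, ∑ z, |qpsK i z s| ≤ CQs)
    (ℓS : SiteY i → UT Nf) (ℓB : BlkY i → UT Nf) {r : ℝ}
    (hℓQ : ∀ s z, qpK i s z ≠ 0 → tdist1 Nf (ℓB s) (ℓS z) ≤ r) (hℓQs : ∀ z s, qpsK i z s ≠ 0 → tdist1 Nf (ℓS z) (ℓB s) ≤ r)
    {mS mB : ℕ} (hfibS : ∀ y : UT Nf, (univ.filter fun q : SiteY i × (Fin N × Fin N) => ℓS q.1 = y).card ≤ mS)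
    (hfibB : ∀ y : UT Nf, (univ.filter fun p : BlkY i × (Fin N × Fin N) => ℓB p.1 = y).card ≤ mB)
    {ρ BG μ : ℝ}
    (hGsq : RawEntryLetters (fun u : Fin (d + 1) → Site (PV d ℓ i.m i.K hd hL) 0 → Matrix (Fin N) (Fin N) ℂ =>
      LinearMap.toMatrix
        ((Pi.basis fun _ : SiteY i => Matrix.stdBasis ℂ (Fin N) (Fin N)).reindex (Equiv.sigmaEquivProd (SiteY i) (Fin N × Fin N)))
        ((Pi.basis fun _ : SiteY i => Matrix.stdBasis ℂ (Fin N) (Fin N)).reindex (Equiv.sigmaEquivProd (SiteY i) (Fin N × Fin N)))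
        (GsqY i (parSymY i) D (prodCfg U₀ η (fun μ y => ((w y : ℝ) : ℂ) • u μ y)))) (fun q : SiteY i × (Fin N × Fin N) => ℓS q.1) Rc ρ BG)
    (hμ : 0 < μ) (hμρ : μ < ρ)
    {BX : ℝ} (hBX : BX = CQ * (Fintype.card (Fin N × Fin N) : ℝ) * (1 * (Real.exp (((d : ℝ) + 1) * (|η| * Rc)) * 1 * Real.exp (((d : ℝ) + 1) * (|η| * Rc)))) *
        (CQs * (Fintype.card (Fin N × Fin N) : ℝ) * (1 * (Real.exp (((d : ℝ) + 1) * (|η| * Rc)) * 1 * Real.exp (((d : ℝ) + 1) * (|η| * Rc))))) *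
        (BG * BG * (mS * B6.c0 1 μ ^ ν)) * Real.exp (2 * (ρ - μ) * r))
    {R' : ℝ} (hR' : 0 ≤ R') (hR'R : R' ≤ Rc)
    (hmarg : 0 < ((4 * ((d : ℝ) + 1) + 1) ^ 2)⁻¹ -
      2 * ((Real.sqrt ((((ℓ : ℝ) + 1) ^ i.k) ^ (d + 1)) * 1 * (BX + 1)) * (mB * B6.c0 1 (ρ - μ) ^ ν)) * R' / Rc)
    {κ : ℝ} (hκ : 0 ≤ κ) (hκ4 : κ ≤ (ρ - μ) / 4)
    (hκm : 8 * (Real.sqrt ((((ℓ : ℝ) + 1) ^ i.k) ^ (d + 1)) * 1 * (BX + 1)) * κ * (mB * B6.c0 1 ((ρ - μ) / 2) ^ ν) ≤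
      (((4 * ((d : ℝ) + 1) + 1) ^ 2)⁻¹ - 2 * ((Real.sqrt ((((ℓ : ℝ) + 1) ^ i.k) ^ (d + 1)) * 1 * (BX + 1)) * (mB * B6.c0 1 (ρ - μ) ^ ν)) * R' / Rc) *
        (ρ - μ)) :
    RawEntryLetters (fun u : Fin (d + 1) → Site (PV d ℓ i.m i.K hd hL) 0 → Matrix (Fin N) (Fin N) ℂ =>
        LinearMap.toMatrix
          ((Pi.basis fun _ : BlkY i => Matrix.stdBasis ℂ (Fin N) (Fin N)).reindex (Equiv.sigmaEquivProd (BlkY i) (Fin N × Fin N)))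
          ((Pi.basis fun _ : BlkY i => Matrix.stdBasis ℂ (Fin N) (Fin N)).reindex (Equiv.sigmaEquivProd (BlkY i) (Fin N × Fin N)))
          (ClocY i (parSymY i) D (cutMulY (blkIndY i Dblk)) (prodCfg U₀ η (fun μ y => ((w y : ℝ) : ℂ) • u μ y))))
      (fun p : BlkY i × (Fin N × Fin N) => ℓB p.1) R'
      κ (1 * Real.sqrt ((((ℓ : ℝ) + 1) ^ i.k) ^ (d + 1)) *
        (4 / (((4 * ((d : ℝ) + 1) + 1) ^ 2)⁻¹ -
          2 * ((Real.sqrt ((((ℓ : ℝ) + 1) ^ i.k) ^ (d + 1)) * 1 * (BX + 1)) * (mB * B6.c0 1 (ρ - μ) ^ ν)) * R' / Rc))) := by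
  have hX := rawEntryLetters_toMatrix_XY_parSymY_scaledPencil_of_mem i hG hU η w hw D hRc.le hCQ0 hCQ hCQs0 hCQs ℓS ℓB hℓQ hℓQs hfibS hGsq hμ hμρ.le
  rw [← hBX] at hX
  exact rawEntryLetters_toMatrix_ClocY_parSymY_scaledPencil_of_XLetters i hG hU η w D hDD ℓB hX (by linarith) hfibB hR' hR'R hmarg hκ hκ4 hκm

end Literature.MathematicalPhysics.QuantumFieldTheory.Balaban1983to89.B13DirichletLocalXCLettersScaled

end
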